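import Literature.Computability.MetaComplexity.FregeVerifierComplete
import Literature.Computability.Complexity.ListFoldBricks
import Literature.Computability.Complexity.SearchToDecision
import HarnessLib

/-!
# A string-level verifier for `textbookFrege` proofs, III: the bricks

Continuation of `FregeVerifierModel.lean` / `FregeVerifierComplete.lean` (towards
`Literature.Computability.Complexity.textbookFrege_hasPolyTimeVerifier`, Cook–Reckhow 1979,
closing remark of §1). The model checker only concatenates strings, compares strings and looks
strings up in lists; this file supplies these operations as total `FP` string functions in the
tree's "algebra of `FP` functions" style (`BrickAlgebra.lean`: records `⟨a₀, ⟨a₁, …⟩⟩`,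
projections `Brick.nthF`/`Brick.sndPow`, `fanoutFn`, `iteFn`, `eqPairFn`, `appendFn`;
`ListFoldBricks.lean`: the fold `Brick.foldFn` of an `FP` step over the items `Brick.decNil L`
of a coded list `L`, and `Brick.anyFn`), each with its value on well-formed records:

* `eqConstFn f w`: the one-bit test `[f z = w]`; `memFn := Brick.anyFn eqPairFn`: **list
  membership** `memFn ⟨t, encList l⟩ = [t ∈ l]` (`memFn_boolPair_encList`);
* `fillFn T`: **string instantiation** of a rule template `T` by the three payload fields of a
  record, `fillFn T z = sfill (sv (nthF 0 z) (nthF 1 z) (nthF 2 z)) T` on every input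
  (`fillFn_apply`);
* `encA`, `encV`: the accumulator `⟨[ok], ⟨encList lines, encList pool⟩⟩` of the checker's fold
  and the step argument `⟨w, ⟨item, accumulator⟩⟩`, with the projections reading them.

## References

* S. Arora, B. Barak, *Computational Complexity: A Modern Approach*, CUP 2009, §1.3 (closure
  of polynomial time under composition and bounded loops).
* S. A. Cook, R. A. Reckhow, *The relative efficiency of propositional proof systems*,
  J. Symbolic Logic 44 (1979), §1 (closing remark).
-/

namespace Literature.Computability.MetaComplexity

open _root_.Computability Complexity Complexity.Brick Polynomial

namespace FregeVerifier

/-! ### One-bit tests -/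

/-- `eqPairFn` answers with one bit on every input. Refactor: twin of
`Literature.Computability.QuantumComplexity.oneBit_eqPairFn` (`QuantumComplexity/FactoringNP.lean`),
re-proved here to keep the import closure small (that file imports `QuantumComplexity.Factoring`);
both are to be hoisted next to `eqPairFn_eq_or` in `Complexity/StringEquality.lean` (or to
`ListFoldBricks.lean`, where the other `oneBit_*` bricks live). [folklore] -/
theorem oneBit_eqPairFn : OneBit eqPairFn := fun w => by
  rcases eqPairFn_eq_or w with h | h
  · exact ⟨true, h⟩
  · exact ⟨false, h⟩

/-- The test "a computed field equals a constant", `z ↦ [f z = w]`. Refactor: twin of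
`Literature.Computability.QuantumComplexity.ADH.eqC` (`QuantumComplexity/ADHMachine.lean`,
`eqC w f`, arguments swapped; with the same `_apply`/`_mem_FP` lemmas), re-defined here to keep
the import closure small (that file imports the ADH path model and
`Cryptography.QuantumCircuitDescFP`); both are to be hoisted, together with `oneBit_eqPairFn`,
next to `fanoutFn_mem_FP` in `Complexity/StringEquality.lean` (or `BrickAlgebra.lean`). [folklore] -/
noncomputable def eqConstFn (f : List Bool → List Bool) (w : List Bool) : List Bool → List Bool :=
  eqPairFn ∘ fanoutFn f (fun _ => w)

/-- Value of `eqConstFn`. [folklore] -/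
@[simp] theorem eqConstFn_apply (f : List Bool → List Bool) (w z : List Bool) :
    eqConstFn f w z = [decide (f z = w)] := by
  simp [eqConstFn, eqPairFn_boolPair]

/-- `eqConstFn` is one-bit. [folklore] -/
theorem oneBit_eqConstFn (f : List Bool → List Bool) (w : List Bool) : OneBit (eqConstFn f w) :=
  fun z => ⟨_, eqConstFn_apply f w z⟩

/-- `eqConstFn f w ∈ FP` for `f ∈ FP`. [folklore] -/
theorem eqConstFn_mem_FP {f : List Bool → List Bool} (hf : f ∈ FP) (w : List Bool) : eqConstFn f w ∈ FP :=
  comp_mem_FP eqPairFn_mem_FP (fanoutFn_mem_FP hf (const_mem_FP _))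

/-- The normalised flag of a field: on a genuine bit `[b]`, `[f z = [true]]` is `[b]`. [folklore] -/
theorem eqConstFn_true_bit (f : List Bool → List Bool) (z : List Bool) (b : Bool) (h : f z = [b]) :
    eqConstFn f [true] z = [b] := by
  rw [eqConstFn_apply, h]; cases b <;> simp

/-! ### List membership -/

/-- **List membership** as the tree's `anyFn` of the string-equality test:
`memFn ⟨t, L⟩ = [∃ a ∈ decNil L, t = a]`. [cite: AroraBarak2009, §1.3] -/
noncomputable def memFn : List Bool → List Bool := anyFn eqPairFn

/-- `memFn ∈ FP`. [folklore] -/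
theorem memFn_mem_FP : memFn ∈ FP := anyFn_mem_FP eqPairFn_mem_FP oneBit_eqPairFn

/-- `memFn` is one-bit. [folklore] -/
theorem oneBit_memFn : OneBit memFn := oneBit_anyFn oneBit_eqPairFn

/-- **`memFn ⟨t, encList l⟩ = [decide (t ∈ l)]`.** [folklore] -/
theorem memFn_boolPair_encList (t : List Bool) (l : List (List Bool)) :
    memFn (boolPair t (encList l)) = [decide (t ∈ l)] := by
  rw [memFn, anyFn_boolPair oneBit_eqPairFn, decNil_encList]
  simp only [eqPairFn_boolPair, List.cons.injEq, and_true, decide_eq_true_eq]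
  congr 1
  exact propext ⟨fun ⟨a, ha, h⟩ => h ▸ ha, fun h => ⟨t, h, rfl⟩⟩

/-! ### String instantiation of templates -/

/-- The `FP` function instantiating the template `T` by the first three fields of a record:
`var i ↦ nthF i` (`i < 3`; other metavariables, absent from the rules, give `ε`), constants and
connectives emit their code bits around the recursively computed parts.
[cite: CookReckhow1979, §2 Def. 2.1 (substitution)] -/
noncomputable def fillFn : PropForm ℕ → (List Bool → List Bool)
  | .var 0 => nthF 0
  | .var 1 => nthF 1
  | .var 2 => nthF 2
  | .var (_ + 3) => fun _ => []
  | .const b => fun _ => [false, true, b]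
  | .neg T => List.cons true ∘ List.cons false ∘ fillFn T
  | .conj T U => List.cons true ∘ List.cons true ∘ List.cons false ∘ appendFn ∘ fanoutFn (fillFn T) (fillFn U)
  | .disj T U => List.cons true ∘ List.cons true ∘ List.cons true ∘ appendFn ∘ fanoutFn (fillFn T) (fillFn U)

/-- `fillFn T ∈ FP`. [folklore] -/
theorem fillFn_mem_FP : ∀ T : PropForm ℕ, fillFn T ∈ FP
  | .var 0 => nthF_mem_FP 0
  | .var 1 => nthF_mem_FP 1
  | .var 2 => nthF_mem_FP 2
  | .var (_ + 3) => const_mem_FP _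
  | .const _ => const_mem_FP _
  | .neg T => comp_mem_FP (cons_mem_FP _) (comp_mem_FP (cons_mem_FP _) (fillFn_mem_FP T))
  | .conj T U => comp_mem_FP (cons_mem_FP _) (comp_mem_FP (cons_mem_FP _) (comp_mem_FP (cons_mem_FP _)
      (comp_mem_FP appendFn_mem_FP (fanoutFn_mem_FP (fillFn_mem_FP T) (fillFn_mem_FP U)))))
  | .disj T U => comp_mem_FP (cons_mem_FP _) (comp_mem_FP (cons_mem_FP _) (comp_mem_FP (cons_mem_FP _)
      (comp_mem_FP appendFn_mem_FP (fanoutFn_mem_FP (fillFn_mem_FP T) (fillFn_mem_FP U)))))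

/-- **`fillFn` is string instantiation by the three fields**, on every input. [folklore] -/
theorem fillFn_apply : ∀ (T : PropForm ℕ) (z : List Bool),
    fillFn T z = sfill (sv (nthF 0 z) (nthF 1 z) (nthF 2 z)) T
  | .var 0, z => rfl
  | .var 1, z => rfl
  | .var 2, z => rfl
  | .var (_ + 3), z => rfl
  | .const _, z => rfl
  | .neg T, z => by simp [fillFn, sfill, fillFn_apply T z]
  | .conj T U, z => by simp [fillFn, sfill, fillFn_apply T z, fillFn_apply U z]
  | .disj T U, z => by simp [fillFn, sfill, fillFn_apply T z, fillFn_apply U z]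

/-- The three payload fields of a record together are at most half its length. [folklore] -/
theorem two_mul_fields_le (z : List Bool) :
    2 * ((nthF 0 z).length + (nthF 1 z).length + (nthF 2 z).length) ≤ z.length := by
  have h0 := length_fstF_sndF_le z
  have h1 : 2 * (nthF 1 z).length + (sndPow 1 z).length ≤ (sndF z).length := by
    simpa using length_nthF_succ_add_sndPow_succ_le 0 z
  have h2 : 2 * (nthF 2 z).length + (sndPow 2 z).length ≤ (sndPow 1 z).length := by
    simpa using length_nthF_succ_add_sndPow_succ_le 1 z
  simp only [nthF_zero]
  omega

/-! ### The accumulator and the step argument of the checker's fold -/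

/-- The accumulator `⟨[ok], ⟨encList lines, encList pool⟩⟩` of the fold: the state of the model.
[folklore] -/
def encA (st : MState) : List Bool :=
  boolPair [st.ok] (boolPair (encList st.lines) (encList st.pool))

/-- The step argument `⟨w, ⟨item, accumulator⟩⟩` of the fold (`Brick.foldFn`: `w` the whole
input, `item` the current item string). [folklore] -/
def encV (w a : List Bool) (st : MState) : List Bool := boolPair w (boolPair a (encA st))

/-- Field `w`. [folklore] -/
@[simp] theorem nthF0_encV (w a : List Bool) (st : MState) : nthF 0 (encV w a st) = w := by simp [encV]
/-- Field `item`. [folklore] -/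
@[simp] theorem nthF1_encV (w a : List Bool) (st : MState) : nthF 1 (encV w a st) = a := by simp [encV]
/-- Field `ok`. [folklore] -/
@[simp] theorem nthF2_encV (w a : List Bool) (st : MState) : nthF 2 (encV w a st) = [st.ok] := by
  simp [encV, encA]
/-- Field `lines`. [folklore] -/
@[simp] theorem nthF3_encV (w a : List Bool) (st : MState) : nthF 3 (encV w a st) = encList st.lines := by
  simp [encV, encA]
/-- Field `pool`. [folklore] -/
@[simp] theorem sndPow3_encV (w a : List Bool) (st : MState) : sndPow 3 (encV w a st) = encList st.pool := by
  simp [encV, encA]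
/-- Field `ok` of the accumulator. [folklore] -/
@[simp] theorem nthF0_encA (st : MState) : nthF 0 (encA st) = [st.ok] := by simp [encA]
/-- Field `lines` of the accumulator. [folklore] -/
@[simp] theorem nthF1_encA (st : MState) : nthF 1 (encA st) = encList st.lines := by simp [encA]

end FregeVerifier

end Literature.Computability.MetaComplexity
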